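import Mathlib
import Literature.NumberTheory.LFunctions.Zhang2022.Section16NsetRemovable
import HarnessLib

/-!
# Zhang (2022) §16 (16.15): "the constraint `n₁ ∈ 𝔫(𝔮)` can be removed" — the EDGE
# `Inline16_varpi2WeightSum → Step16_u036L → (multiplicativity of ϖ₂ⱼ along smooth × rough) → Inline16_nsetRemovable`

Topic `Literature/NumberTheory/LFunctions/Zhang2022` (Landau–Siegel audit tree; verdict-neutral).
Y. Zhang, *Discrete mean estimates and the Landau–Siegel zero*, arXiv:2211.02515v1 (2022)
[Zhang2022LandauSiegel] — **an unrefereed manuscript under adjudication**; nothing here bears on its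
Theorems 1–2. ZHANG-L discharge lane (WP16, seat zl-w16-p4, helper of zl-w16-p8), node
`Typed.Section16B.Inline16_nsetRemovable c′` (§16 p. 94, tex L4638: "On the right side above, the
constraint `n₁ ∈ 𝔫(𝔮)` can be removed with an acceptable error"; rate read as the `O(1/𝓛)` of (16.15)).

PROVED here (theorems only; no definitions, no named facts): `inline16_nsetRemovable_of` — from
(1) `Inline16_varpi2WeightSum c′` (`Σ_{n₁∈𝒩(𝔮),n₁<T}|ϖ₂ⱼ|τ₃/n₁ ≤ C𝓛⁶`), (2) the local bound
`Step16_u036L c′` (`|ϖ₂ⱼ^{loc}(l)| ≤ C(α𝓛 + |ν(q)|)` for rough `1 < l < T⁵`, `q ∣ l`; F16B-1 reading,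
`TypedSection16BLocal`), and (3) the multiplicativity of `ϖ₂ⱼ` along the smooth × rough factorisation,
`ϖ₂ⱼ(mb) = ϖ₂ⱼ(m)ϖ₂ⱼ^{loc}(b)` for `m ∈ 𝒩(𝔮)`, `(b,𝔮) = 1` (spelled INLINE; the lane's locality lemma
for the Euler product `𝓜₂`), the node follows: the removed terms are `𝔢ⱼΣ_{n<T, n∉𝒩(𝔮)}ϖ₂ⱼ(n)(ν∗χ)(n)/n`,
bounded via `n = mb` (`sum_not_nset_le_sum_smooth_mul_rough`), `|(ν∗χ)(mb)| ≤ τ₃(m)τ₃(b)`, the smooth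
factor `≤ C𝓛⁶`, and the rough factor `≤ C(α𝓛·R₁ + R₂)` with `R₁ = Σ_{rough b<T}τ₃(b)/b ≤ e^{59}𝓛`
(`sum_rough_tau3R_div_le`: `≍ (log T/log D⁴)³ = 𝓛^{0.3}`) and `R₂ ≤ 3(Σ_{D⁴<q≤T}|ν(q)|²/q)R₁ ≪ 𝓛⁻²⁰¹¹·𝓛`
(`sum_rough_nu_tau3R_div_le` + Lemma 3.1 `Lemma31.lemma_3_1`); total `≪ (α𝓛·𝓛⁷ + 𝓛^{7−2011}) ≪ 𝓛⁻¹`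
since `α𝓛 = π𝓛⁻⁸`.

## References

* Y. Zhang, arXiv:2211.02515v1 (2022), §16 (16.15) p. 94, tex L4634–L4640; §3 Lemma 3.1 p. 7; §15
  p. 86. [cite: Zhang2022LandauSiegel, §16 (16.15) p.94]
-/

noncomputable section

open Real Finset
open Literature.NumberTheory.LFunctions.Zhang2022
open Literature.NumberTheory.LFunctions.Zhang2022.Skeleton
open Literature.NumberTheory.LFunctions.Zhang2022.SmoothEulerMajorant

namespace Literature.NumberTheory.LFunctions.Zhang2022.Typed.Section16B

/-! ## Sizes of the campaign parameters (`𝓛 ≥ 4¹⁰`) -/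

/-- For `𝓛 = log D ≥ 4¹⁰`: `D ≥ 2`, `2 ≤ D⁴ − 1`, `D⁴ ≤ ⌈T⌉`, `⌈T⌉ ≤ e^{2𝓛⁹}`, `⌈T⌉ ≤ T + 1 ≤ T⁵`, and
`e^{58+48/log(D⁴−1)}(log⌈T⌉/log(D⁴−1))³ ≤ e^{59}𝓛` (`T = e^{𝓛^{1.1}}`, `log⌈T⌉ ≤ 2𝓛^{1.1}`,
`log(D⁴−1) ≥ 3𝓛`, `(2𝓛^{0.1}/3)³ ≤ 𝓛`). [cite: Zhang2022LandauSiegel, §2 p.4, §6 (T)] -/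
theorem nsetRemovable_sizes {D : ℕ} (hℓ : (4 : ℝ) ^ 10 ≤ ell D) :
    2 ≤ D ∧ 2 ≤ D ^ 4 - 1 ∧ D ^ 4 ≤ ⌈bigT D⌉₊ ∧
      ((⌈bigT D⌉₊ : ℕ) : ℝ) ≤ Real.exp (2 * Real.log D ^ 9) ∧
      ((⌈bigT D⌉₊ : ℕ) : ℝ) ≤ bigT D + 1 ∧ bigT D + 1 ≤ bigT D ^ 5 ∧
      Real.exp (54 + 4 + 16 * (3 : ℕ) / Real.log ((D ^ 4 - 1 : ℕ) : ℝ)) *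
          (Real.log ((⌈bigT D⌉₊ : ℕ) : ℝ) / Real.log ((D ^ 4 - 1 : ℕ) : ℝ)) ^ 3 ≤
        Real.exp 59 * ell D := by
  have h410 : (4 : ℝ) ^ 10 = 1048576 := by norm_num
  have hℓ1 : 1 ≤ ell D := by linarith
  have hℓ0 : 0 < ell D := by linarith
  -- `D` as a real: `D = e^{𝓛}`
  have hD0 : 0 < D := by
    by_contra h
    have : D = 0 := by omega
    subst this
    simp [ell] at hℓ0
  have hDexp : (D : ℝ) = Real.exp (ell D) := by
    rw [ell, Real.exp_log (by exact_mod_cast hD0)]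
  have hD2 : 2 ≤ D := by
    by_contra h
    have h1 : D = 1 := by omega
    subst h1
    simp [ell] at hℓ0
  have hD4r : ((D ^ 4 : ℕ) : ℝ) = Real.exp (4 * ell D) := by
    push_cast; rw [hDexp, ← Real.exp_nat_mul]; norm_num
  have hD42 : 2 ≤ D ^ 4 - 1 := by
    have : 16 ≤ D ^ 4 := by nlinarith [Nat.pow_le_pow_left hD2 4]
    omega
  -- `T = e^{𝓛^{1.1}}`, `𝓛^{1.1} = 𝓛·𝓛^{0.1}`, `𝓛^{0.1} ≥ 4`
  have hT : bigT D = Real.exp (ell D ^ (1.1 : ℝ)) := rfl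
  have hsplit : ell D ^ (1.1 : ℝ) = ell D * ell D ^ (0.1 : ℝ) := by
    rw [show (1.1 : ℝ) = 1 + 0.1 by norm_num, Real.rpow_add hℓ0, Real.rpow_one]
  have h01 : (4 : ℝ) ≤ ell D ^ (0.1 : ℝ) := by
    have h4 : (4 : ℝ) = ((4 : ℝ) ^ 10) ^ (0.1 : ℝ) := by
      rw [show (0.1 : ℝ) = ((10 : ℕ) : ℝ)⁻¹ by norm_num]
      exact (Real.pow_rpow_inv_natCast (by norm_num) (by norm_num)).symm
    rw [h4]
    exact Real.rpow_le_rpow (by positivity) hℓ (by norm_num)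
  have h01le : ell D ^ (0.1 : ℝ) ≤ ell D := by
    calc ell D ^ (0.1 : ℝ) ≤ ell D ^ (1 : ℝ) := Real.rpow_le_rpow_of_exponent_le hℓ1 (by norm_num)
      _ = ell D := Real.rpow_one _
  have h11ge : 4 * ell D ≤ ell D ^ (1.1 : ℝ) := by
    rw [hsplit]; nlinarith
  have h11le9 : ell D ^ (1.1 : ℝ) ≤ ell D ^ 9 := by
    calc ell D ^ (1.1 : ℝ) ≤ ell D ^ ((9 : ℕ) : ℝ) :=
          Real.rpow_le_rpow_of_exponent_le hℓ1 (by norm_num)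
      _ = ell D ^ 9 := Real.rpow_natCast _ _
  have hT1 : 1 ≤ bigT D := by rw [hT]; exact Real.one_le_exp (by positivity)
  have hTD4 : ((D ^ 4 : ℕ) : ℝ) ≤ bigT D := by
    rw [hD4r, hT]; exact Real.exp_le_exp.mpr h11ge
  have hceil : ((⌈bigT D⌉₊ : ℕ) : ℝ) ≤ bigT D + 1 := (Nat.ceil_lt_add_one (by linarith)).le
  have hceil' : bigT D ≤ ((⌈bigT D⌉₊ : ℕ) : ℝ) := Nat.le_ceil _
  have hN : D ^ 4 ≤ ⌈bigT D⌉₊ := by exact_mod_cast hTD4.trans hceil'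
  have hNexp : ((⌈bigT D⌉₊ : ℕ) : ℝ) ≤ Real.exp (2 * Real.log D ^ 9) := by
    refine hceil.trans ?_
    rw [hT, ← ell]
    have h2 : Real.exp (ell D ^ (1.1 : ℝ)) + 1 ≤ 2 * Real.exp (ell D ^ (1.1 : ℝ)) := by
      linarith [Real.one_le_exp (show 0 ≤ ell D ^ (1.1 : ℝ) by positivity)]
    refine h2.trans ?_
    have h3 : (2 : ℝ) ≤ Real.exp (ell D ^ 9) := by
      have : ell D ^ 9 ≥ 1 := one_le_pow₀ hℓ1
      linarith [Real.add_one_le_exp (ell D ^ 9)]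
    calc 2 * Real.exp (ell D ^ (1.1 : ℝ)) ≤ Real.exp (ell D ^ 9) * Real.exp (ell D ^ 9) :=
          mul_le_mul h3 (Real.exp_le_exp.mpr h11le9) (Real.exp_pos _).le (Real.exp_pos _).le
      _ = Real.exp (2 * ell D ^ 9) := by rw [← Real.exp_add]; ring_nf
  have hT5 : bigT D + 1 ≤ bigT D ^ 5 := by
    have hT2 : 2 ≤ bigT D := by
      rw [hT]
      have : (1 : ℝ) ≤ ell D ^ (1.1 : ℝ) := by linarith
      linarith [Real.add_one_le_exp (ell D ^ (1.1 : ℝ))]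
    have h4 : bigT D ≤ bigT D ^ 4 := le_self_pow₀ hT1 (by norm_num)
    have h5 : bigT D ^ 5 = bigT D * bigT D ^ 4 := by ring
    have h6 : bigT D * bigT D ≤ bigT D * bigT D ^ 4 := mul_le_mul_of_nonneg_left h4 (by linarith)
    rw [h5]
    nlinarith
  -- the window `τ₃`-sum envelope
  have hlogN : Real.log ((⌈bigT D⌉₊ : ℕ) : ℝ) ≤ 2 * ell D ^ (1.1 : ℝ) := by
    have hpos : (0 : ℝ) < ((⌈bigT D⌉₊ : ℕ) : ℝ) := by linarith
    calc Real.log ((⌈bigT D⌉₊ : ℕ) : ℝ) ≤ Real.log (2 * bigT D) :=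
          Real.log_le_log hpos (by linarith)
      _ = Real.log 2 + ell D ^ (1.1 : ℝ) := by
          rw [Real.log_mul (by norm_num) (by linarith), hT, Real.log_exp]
      _ ≤ 2 * ell D ^ (1.1 : ℝ) := by
          have : Real.log 2 ≤ 1 := by
            have := Real.log_two_lt_d9; linarith
          have : (1 : ℝ) ≤ ell D ^ (1.1 : ℝ) := by linarith
          linarith
  have hlogD41 : 3 * ell D ≤ Real.log ((D ^ 4 - 1 : ℕ) : ℝ) := by
    -- `D⁴ − 1 ≥ D⁴/2 = e^{4𝓛}/2`, `log ≥ 4𝓛 − log 2 ≥ 3𝓛`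
    have hcast : ((D ^ 4 - 1 : ℕ) : ℝ) = ((D ^ 4 : ℕ) : ℝ) - 1 := by
      have : 1 ≤ D ^ 4 := Nat.one_le_pow _ _ hD0
      push_cast [Nat.cast_sub this]; ring
    have hhalf : ((D ^ 4 : ℕ) : ℝ) / 2 ≤ ((D ^ 4 - 1 : ℕ) : ℝ) := by
      rw [hcast]
      have : (16 : ℝ) ≤ ((D ^ 4 : ℕ) : ℝ) := by
        have : 16 ≤ D ^ 4 := by nlinarith [Nat.pow_le_pow_left hD2 4]
        exact_mod_cast this
      linarith
    have hpos : (0 : ℝ) < ((D ^ 4 : ℕ) : ℝ) / 2 := by rw [hD4r]; positivity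
    calc 3 * ell D ≤ 4 * ell D - Real.log 2 := by
          have := Real.log_two_lt_d9; linarith
      _ = Real.log (((D ^ 4 : ℕ) : ℝ) / 2) := by
          rw [Real.log_div (by rw [hD4r]; positivity) (by norm_num), hD4r, Real.log_exp]
      _ ≤ Real.log ((D ^ 4 - 1 : ℕ) : ℝ) := Real.log_le_log hpos hhalf
  have hlogD41pos : 0 < Real.log ((D ^ 4 - 1 : ℕ) : ℝ) := by linarith
  have hratio : Real.log ((⌈bigT D⌉₊ : ℕ) : ℝ) / Real.log ((D ^ 4 - 1 : ℕ) : ℝ) ≤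
      2 / 3 * ell D ^ (0.1 : ℝ) := by
    rw [div_le_iff₀ hlogD41pos]
    calc Real.log ((⌈bigT D⌉₊ : ℕ) : ℝ) ≤ 2 * ell D ^ (1.1 : ℝ) := hlogN
      _ = 2 / 3 * ell D ^ (0.1 : ℝ) * (3 * ell D) := by rw [hsplit]; ring
      _ ≤ 2 / 3 * ell D ^ (0.1 : ℝ) * Real.log ((D ^ 4 - 1 : ℕ) : ℝ) :=
          mul_le_mul_of_nonneg_left hlogD41 (by positivity)
  have hratio0 : 0 ≤ Real.log ((⌈bigT D⌉₊ : ℕ) : ℝ) / Real.log ((D ^ 4 - 1 : ℕ) : ℝ) :=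
    div_nonneg (Real.log_natCast_nonneg _) hlogD41pos.le
  have hcube : (Real.log ((⌈bigT D⌉₊ : ℕ) : ℝ) / Real.log ((D ^ 4 - 1 : ℕ) : ℝ)) ^ 3 ≤ ell D := by
    have h03 : (ell D ^ (0.1 : ℝ)) ^ 3 = ell D ^ (0.3 : ℝ) := by
      rw [← Real.rpow_natCast, ← Real.rpow_mul hℓ0.le]; norm_num
    have h03le : ell D ^ (0.3 : ℝ) ≤ ell D := by
      calc ell D ^ (0.3 : ℝ) ≤ ell D ^ (1 : ℝ) := Real.rpow_le_rpow_of_exponent_le hℓ1 (by norm_num)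
        _ = ell D := Real.rpow_one _
    calc (Real.log ((⌈bigT D⌉₊ : ℕ) : ℝ) / Real.log ((D ^ 4 - 1 : ℕ) : ℝ)) ^ 3
        ≤ (2 / 3 * ell D ^ (0.1 : ℝ)) ^ 3 := pow_le_pow_left₀ hratio0 hratio 3
      _ = 8 / 27 * (ell D ^ (0.1 : ℝ)) ^ 3 := by ring
      _ ≤ 1 * ell D := by rw [h03]; nlinarith [Real.rpow_nonneg hℓ0.le (0.3 : ℝ)]
      _ = ell D := one_mul _
  have hexp : Real.exp (54 + 4 + 16 * (3 : ℕ) / Real.log ((D ^ 4 - 1 : ℕ) : ℝ)) ≤ Real.exp 59 := by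
    apply Real.exp_le_exp.mpr
    have : 16 * (3 : ℕ) / Real.log ((D ^ 4 - 1 : ℕ) : ℝ) ≤ 1 := by
      rw [div_le_one hlogD41pos]; push_cast; linarith
    push_cast at this ⊢; linarith
  refine ⟨hD2, hD42, hN, hNexp, hceil, hT5, ?_⟩
  exact mul_le_mul hexp hcube (pow_nonneg hratio0 3) (Real.exp_pos _).le


/-! ## The edge -/

set_option maxHeartbeats 1600000 in
open scoped Classical in
/-- **`Inline16_nsetRemovable` from `Inline16_varpi2WeightSum`, `Step16_u036L` and the multiplicativity
of `ϖ₂ⱼ` along the smooth × rough factorisation** (the lane's route of record for §16 p. 94 "the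
constraint `n₁ ∈ 𝔫(𝔮)` can be removed with an acceptable error", rate `O(1/𝓛)`): see the module
docstring for the chain of estimates; the multiplicativity input (3) is spelled inline.
[cite: Zhang2022LandauSiegel, §16 (16.15) p.94] -/
theorem inline16_nsetRemovable_of (c' : ℝ) (hW : Inline16_varpi2WeightSum c')
    (h36 : Step16_u036L c')
    (hmult : ForAllLarge fun D _ χ => AssumptionA D χ → ∀ j ∈ ({1, 2} : Finset ℕ), ∀ m b : ℕ,
      m ∈ nset (frakq D) → 1 ≤ b → Nat.Coprime b (frakq D) →
        varpi2 c' χ j (m * b) = varpi2 c' χ j m * varpi2loc c' χ j b) :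
    Inline16_nsetRemovable c' := by
  obtain ⟨C_W, hWF⟩ := hW
  obtain ⟨C₆, h36F⟩ := h36
  obtain ⟨C₁, hC₁⟩ := Lemma31.lemma_3_1
  obtain ⟨D₁, hD₁⟩ := exists_forall_le_ell ((4 : ℝ) ^ 10)
  obtain ⟨D₂, h₂⟩ := (hWF.and h36F).and hmult
  set E : ℝ := ‖frake 1‖ + ‖frake 2‖ with hE
  set C_W' : ℝ := max C_W 0 with hCW'
  set C₆' : ℝ := max C₆ 0 with hC₆'
  set C₁' : ℝ := max C₁ 0 with hC₁'
  refine ⟨E * C_W' * C₆' * Real.exp 59 * (Real.pi + 3 * C₁'), max D₁ D₂,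
    fun D _ χ hD hq hp hA j hj => ?_⟩
  have hℓ : (4 : ℝ) ^ 10 ≤ ell D := hD₁ D (le_trans (le_max_left _ _) hD)
  obtain ⟨⟨eW, e36⟩, emul⟩ := h₂ D χ (le_trans (le_max_right _ _) hD) hq hp
  have eW := eW hA j hj
  have e36 := e36 hA j hj
  have emul := emul hA j hj
  obtain ⟨hD2, hD42, hN4, hNexp, hceil, hT5, hB1⟩ := nsetRemovable_sizes hℓ
  have h410 : (4 : ℝ) ^ 10 = 1048576 := by norm_num
  have hℓ1 : 1 ≤ ell D := by linarith
  have hℓ0 : 0 < ell D := by linarith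
  have hℓ3 : 3 ≤ Real.log D := by rw [← ell]; linarith
  -- notation
  set N : ℕ := ⌈bigT D⌉₊ with hN
  set K : ℕ := frakq D with hK
  set S := (Finset.Ico 1 N).filter (fun n => n ∈ nset K) with hS
  set X := (Finset.Ico 1 N).filter (fun n => n ∉ nset K) with hX
  set R := (Finset.Ico 2 N).filter (fun b => Nat.Coprime b K) with hR
  set R' := (Finset.Ico 1 N).filter (fun b => Nat.Coprime b K) with hR'
  set f : ℕ → ℂ := fun n => varpi2 c' χ j n * nuConvChi χ n / (n : ℂ) with hf
  set g : ℕ → ℝ := fun n => ‖varpi2 c' χ j n‖ * ‖nuConvChi χ n‖ / n with hg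
  have hg0 : ∀ n, 0 ≤ g n := fun n => by rw [hg]; positivity
  have hfg : ∀ n, ‖f n‖ = g n := fun n => by
    simp only [hf, hg, norm_div, norm_mul, Complex.norm_natCast]
  -- Step 1: the difference is `−𝔢ⱼ Σ_X f`
  have hsplit : ∑ n ∈ Finset.Ico 1 N, f n = ∑ n ∈ S, f n + ∑ n ∈ X, f n :=
    (Finset.sum_filter_add_sum_filter_not _ _ _).symm
  have hdiff : frake j * ∑ n ∈ S, f n - frake j * ∑ n ∈ Finset.Ico 1 N, f n =
      -(frake j * ∑ n ∈ X, f n) := by rw [hsplit]; ring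
  have hEj : ‖frake j‖ ≤ E := norm_frake_le_of_mem hj
  have hE0 : 0 ≤ E := le_trans (norm_nonneg _) hEj
  have step1 : ‖frake j * ∑ n ∈ S, f n - frake j * ∑ n ∈ Finset.Ico 1 N, f n‖ ≤
      E * ∑ n ∈ X, g n := by
    rw [hdiff, norm_neg, norm_mul]
    refine mul_le_mul hEj ((norm_sum_le _ _).trans (le_of_eq ?_)) (norm_nonneg _) hE0
    exact Finset.sum_congr rfl fun n _ => hfg n
  -- Step 2: the non-smooth sum is covered by smooth × rough
  have step2 : ∑ n ∈ X, g n ≤ ∑ m ∈ S, ∑ b ∈ R, g (m * b) :=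
    sum_not_nset_le_sum_smooth_mul_rough D N hg0
  -- Step 3: termwise bound on `g(mb)`
  have hα0 : 0 < alpha D := Skeleton.alpha_pos_of_ell_pos hℓ0
  have hC₆' : C₆ ≤ C₆' := le_max_left _ _
  have hC₆'0 : 0 ≤ C₆' := le_max_right _ _
  have hT0 : 0 < bigT D := Real.exp_pos _
  have step3 : ∀ m ∈ S, ∀ b ∈ R, g (m * b) ≤
      (‖varpi2 c' χ j m‖ * tau3R m / m) *
        (C₆' * (alpha D * ell D * (tau3R b / b) + ‖nu χ (Nat.minFac b)‖ * tau3R b / b)) := by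
    intro m hm b hb
    rw [hS, Finset.mem_filter, Finset.mem_Ico] at hm
    rw [hR, Finset.mem_filter, Finset.mem_Ico] at hb
    obtain ⟨⟨hm1, hmN⟩, hmS⟩ := hm
    obtain ⟨⟨hb2, hbN⟩, hbcop⟩ := hb
    have hb1 : b ≠ 1 := by omega
    have hmb : Nat.Coprime m b := Typed.Section15B.coprime_of_mem_nset_of_coprime hmS hbcop
    have hpm : (Nat.minFac b).Prime := Nat.minFac_prime hb1
    have hbT : (b : ℝ) < bigT D ^ 5 := by
      have : (b : ℝ) < (N : ℝ) := by exact_mod_cast hbN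
      linarith
    have hloc : ‖varpi2loc c' χ j b‖ ≤ C₆' * (alpha D * ell D + ‖nu χ (Nat.minFac b)‖) := by
      refine (e36 b (by omega) hbT hbcop _ hpm (Nat.minFac_dvd b)).trans ?_
      exact mul_le_mul_of_nonneg_right hC₆' (by positivity)
    have hνχ : ‖nuConvChi χ (m * b)‖ ≤ tau3R m * tau3R b := by
      rw [← tau3R_mul_of_coprime hmb]
      exact norm_nuConvChi_le_tau3R χ (Nat.one_le_iff_ne_zero.mpr (Nat.mul_ne_zero (by omega) (by omega)))
    have hm0 : (0 : ℝ) < m := by exact_mod_cast hm1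
    have hb0 : (0 : ℝ) < b := by exact_mod_cast (show 0 < b by omega)
    have hτm := Finset.sum_nonneg (fun x (_ : x ∈ m.divisors) => (Nat.cast_nonneg (α := ℝ) x.divisors.card))
    have hτb := Finset.sum_nonneg (fun x (_ : x ∈ b.divisors) => (Nat.cast_nonneg (α := ℝ) x.divisors.card))
    change 0 ≤ tau3R m at hτm
    change 0 ≤ tau3R b at hτb
    rw [hg]
    simp only
    rw [emul m b hmS (by omega) hbcop, norm_mul, Nat.cast_mul]
    -- `‖ϖ m‖‖ϖloc b‖‖νχ(mb)‖/(m b) ≤ ‖ϖ m‖ (C₆'(αℓ + ‖ν‖)) (τ₃ m τ₃ b)/(m b)`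
    have hnum : ‖varpi2 c' χ j m‖ * ‖varpi2loc c' χ j b‖ * ‖nuConvChi χ (m * b)‖ ≤
        ‖varpi2 c' χ j m‖ * (C₆' * (alpha D * ell D + ‖nu χ (Nat.minFac b)‖)) * (tau3R m * tau3R b) :=
      mul_le_mul (mul_le_mul_of_nonneg_left hloc (norm_nonneg _)) hνχ (norm_nonneg _)
        (mul_nonneg (norm_nonneg _) (by positivity))
    calc ‖varpi2 c' χ j m‖ * ‖varpi2loc c' χ j b‖ * ‖nuConvChi χ (m * b)‖ / (↑m * ↑b)
        ≤ ‖varpi2 c' χ j m‖ * (C₆' * (alpha D * ell D + ‖nu χ (Nat.minFac b)‖)) *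
            (tau3R m * tau3R b) / (↑m * ↑b) :=
          div_le_div_of_nonneg_right hnum (by positivity)
      _ = (‖varpi2 c' χ j m‖ * tau3R m / m) *
            (C₆' * (alpha D * ell D * (tau3R b / b) + ‖nu χ (Nat.minFac b)‖ * tau3R b / b)) := by
          field_simp
  -- Step 4: factor the double sum
  set W : ℝ := ∑ m ∈ S, ‖varpi2 c' χ j m‖ * tau3R m / m with hWdef
  set R₁ : ℝ := ∑ b ∈ R, tau3R b / b with hR₁
  set R₂ : ℝ := ∑ b ∈ R, ‖nu χ (Nat.minFac b)‖ * tau3R b / b with hR₂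
  set R₁' : ℝ := ∑ b ∈ R', tau3R b / b with hR₁'
  set Λ : ℝ := ∑ q ∈ (Finset.Ioc (D ^ 4) N).filter Nat.Prime, ‖nu χ q‖ ^ 2 / q with hΛ
  have hτ0 : ∀ n : ℕ, 0 ≤ tau3R n := fun n =>
    Finset.sum_nonneg (fun x (_ : x ∈ n.divisors) => (Nat.cast_nonneg (α := ℝ) x.divisors.card))
  have hW0 : 0 ≤ W := Finset.sum_nonneg fun m _ => by have := hτ0 m; positivity
  have hR₁0 : 0 ≤ R₁ := Finset.sum_nonneg fun b _ => by have := hτ0 b; positivity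
  have hR₁'0 : 0 ≤ R₁' := Finset.sum_nonneg fun b _ => by have := hτ0 b; positivity
  have hΛ0 : 0 ≤ Λ := Finset.sum_nonneg fun q _ => by positivity
  have hR₂0 : 0 ≤ R₂ := Finset.sum_nonneg fun b _ => by have := hτ0 b; positivity
  have hsumR : ∑ b ∈ R, C₆' * (alpha D * ell D * (tau3R b / b) + ‖nu χ (Nat.minFac b)‖ * tau3R b / b) =
      C₆' * (alpha D * ell D * R₁ + R₂) := by
    rw [hR₁, hR₂]
    conv_rhs => rw [Finset.mul_sum, ← Finset.sum_add_distrib, Finset.mul_sum]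
  have step4 : ∑ m ∈ S, ∑ b ∈ R, g (m * b) ≤ W * (C₆' * (alpha D * ell D * R₁ + R₂)) := by
    calc ∑ m ∈ S, ∑ b ∈ R, g (m * b)
        ≤ ∑ m ∈ S, ∑ b ∈ R, (‖varpi2 c' χ j m‖ * tau3R m / m) *
            (C₆' * (alpha D * ell D * (tau3R b / b) + ‖nu χ (Nat.minFac b)‖ * tau3R b / b)) :=
          Finset.sum_le_sum fun m hm => Finset.sum_le_sum fun b hb => step3 m hm b hb
      _ = ∑ m ∈ S, (‖varpi2 c' χ j m‖ * tau3R m / m) *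
            ∑ b ∈ R, C₆' * (alpha D * ell D * (tau3R b / b) + ‖nu χ (Nat.minFac b)‖ * tau3R b / b) := by
          refine Finset.sum_congr rfl fun m _ => ?_
          rw [Finset.mul_sum]
      _ = W * (C₆' * (alpha D * ell D * R₁ + R₂)) := by
          rw [← Finset.sum_mul, hsumR]
  -- the four size inputs
  have hWle : W ≤ C_W' * ell D ^ 6 :=
    eW.trans (mul_le_mul_of_nonneg_right (le_max_left _ _) (by positivity))
  have hRsub : R ⊆ R' := by
    intro b hb
    rw [hR, Finset.mem_filter, Finset.mem_Ico] at hb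
    rw [hR', Finset.mem_filter, Finset.mem_Ico]
    exact ⟨⟨by omega, hb.1.2⟩, hb.2⟩
  have hR₁le : R₁ ≤ R₁' :=
    Finset.sum_le_sum_of_subset_of_nonneg hRsub fun b _ _ => by have := hτ0 b; positivity
  have hR₁'le : R₁' ≤ Real.exp 59 * ell D := (sum_rough_tau3R_div_le hD42 hN4).trans hB1
  have hR₂le : R₂ ≤ 3 * Λ * R₁' := sum_rough_nu_tau3R_div_le χ hq hD2 N
  have hΛle : Λ ≤ C₁' / ell D ^ 2011 := by
    have hAle : ‖χ.LFunction 1‖ ≤ 1 / Real.log D ^ 2022 := by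
      have := hA; rw [AssumptionA] at this; exact this.le
    have h31 := hC₁ D χ hp hq.sq_eq_one hℓ3 hAle N hNexp
    have hsub : (Finset.Ioc (D ^ 4) N).filter Nat.Prime ⊆ Finset.Ioc (D ^ 4) N := Finset.filter_subset _ _
    calc Λ ≤ ∑ n ∈ Finset.Ioc (D ^ 4) N, ‖nu χ n‖ ^ 2 / n :=
          Finset.sum_le_sum_of_subset_of_nonneg hsub fun n _ _ => by positivity
      _ ≤ C₁ / Real.log D ^ 2011 := h31
      _ ≤ C₁' / ell D ^ 2011 := by
          rw [← ell]; exact div_le_div_of_nonneg_right (le_max_left _ _) (by positivity)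
  -- Step 5: the size bookkeeping `ℓ⁷(αℓ + 3C₁'ℓ⁻²⁰¹¹) ≤ (π + 3C₁')/ℓ`
  have hαℓ8 : alpha D * ell D * ell D ^ 7 = Real.pi / ell D := by
    have h9 := Skeleton.alpha_mul_ell_pow_nine (D := D) hℓ0
    field_simp
    linear_combination h9
  have hpow : ell D ^ 7 * (C₁' / ell D ^ 2011) ≤ C₁' / ell D := by
    have hC₁'0 : 0 ≤ C₁' := le_max_right _ _
    have key : ell D ^ 7 / ell D ^ 2011 ≤ 1 / ell D := by
      rw [div_le_div_iff₀ (by positivity) hℓ0, one_mul, ← pow_succ]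
      exact pow_le_pow_right₀ hℓ1 (by norm_num)
    calc ell D ^ 7 * (C₁' / ell D ^ 2011) = C₁' * (ell D ^ 7 / ell D ^ 2011) := by ring
      _ ≤ C₁' * (1 / ell D) := mul_le_mul_of_nonneg_left key hC₁'0
      _ = C₁' / ell D := by ring
  have hC₁'0 : 0 ≤ C₁' := le_max_right _ _
  have hCW'0 : 0 ≤ C_W' := le_max_right _ _
  -- assemble
  have hinner : C₆' * (alpha D * ell D * R₁ + R₂) ≤
      C₆' * (Real.exp 59 * ell D) * (alpha D * ell D + 3 * (C₁' / ell D ^ 2011)) := by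
    have h1 : alpha D * ell D * R₁ ≤ alpha D * ell D * (Real.exp 59 * ell D) :=
      mul_le_mul_of_nonneg_left (hR₁le.trans hR₁'le) (by positivity)
    have h2 : R₂ ≤ 3 * (C₁' / ell D ^ 2011) * (Real.exp 59 * ell D) :=
      hR₂le.trans (mul_le_mul (mul_le_mul_of_nonneg_left hΛle (by norm_num)) hR₁'le hR₁'0
        (by positivity))
    calc C₆' * (alpha D * ell D * R₁ + R₂)
        ≤ C₆' * (alpha D * ell D * (Real.exp 59 * ell D) +
            3 * (C₁' / ell D ^ 2011) * (Real.exp 59 * ell D)) :=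
          mul_le_mul_of_nonneg_left (add_le_add h1 h2) hC₆'0
      _ = C₆' * (Real.exp 59 * ell D) * (alpha D * ell D + 3 * (C₁' / ell D ^ 2011)) := by ring
  have htotal : E * ∑ n ∈ X, g n ≤
      E * C_W' * C₆' * Real.exp 59 * (Real.pi + 3 * C₁') * (ell D)⁻¹ := by
    have hX0 : 0 ≤ ∑ n ∈ X, g n := Finset.sum_nonneg fun n _ => hg0 n
    have h1 : ∑ n ∈ X, g n ≤ (C_W' * ell D ^ 6) *
        (C₆' * (Real.exp 59 * ell D) * (alpha D * ell D + 3 * (C₁' / ell D ^ 2011))) :=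
      (step2.trans step4).trans (mul_le_mul hWle hinner
        (mul_nonneg hC₆'0 (add_nonneg (mul_nonneg (mul_nonneg hα0.le hℓ0.le) hR₁0) hR₂0))
        (by positivity))
    have h2 : (C_W' * ell D ^ 6) *
        (C₆' * (Real.exp 59 * ell D) * (alpha D * ell D + 3 * (C₁' / ell D ^ 2011))) =
        C_W' * C₆' * Real.exp 59 *
          (alpha D * ell D * ell D ^ 7 + 3 * (ell D ^ 7 * (C₁' / ell D ^ 2011))) := by ring
    have h3 : alpha D * ell D * ell D ^ 7 + 3 * (ell D ^ 7 * (C₁' / ell D ^ 2011)) ≤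
        (Real.pi + 3 * C₁') * (ell D)⁻¹ := by
      calc alpha D * ell D * ell D ^ 7 + 3 * (ell D ^ 7 * (C₁' / ell D ^ 2011))
          = Real.pi / ell D + 3 * (ell D ^ 7 * (C₁' / ell D ^ 2011)) := by rw [hαℓ8]
        _ ≤ Real.pi / ell D + 3 * (C₁' / ell D) := by linarith [hpow]
        _ = (Real.pi + 3 * C₁') * (ell D)⁻¹ := by ring
    calc E * ∑ n ∈ X, g n
        ≤ E * (C_W' * C₆' * Real.exp 59 *
            (alpha D * ell D * ell D ^ 7 + 3 * (ell D ^ 7 * (C₁' / ell D ^ 2011)))) := by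
          rw [← h2]; exact mul_le_mul_of_nonneg_left h1 hE0
      _ ≤ E * (C_W' * C₆' * Real.exp 59 * ((Real.pi + 3 * C₁') * (ell D)⁻¹)) := by
          refine mul_le_mul_of_nonneg_left (mul_le_mul_of_nonneg_left h3 (by positivity)) hE0
      _ = E * C_W' * C₆' * Real.exp 59 * (Real.pi + 3 * C₁') * (ell D)⁻¹ := by ring
  exact step1.trans htotal

end Literature.NumberTheory.LFunctions.Zhang2022.Typed.Section16B

end
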